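import Summits.NavierStokesRegularity.NavierStokesRegularity.Theses.PerpetualPump
import Summits.NavierStokesRegularity.NavierStokesRegularity.Theorems.AveragedTypeIBlowup.Negative.NSReduction
import Literature.Analysis.FluidPDE.TaoAveragedCascadeHolds

/-!
# Crux `Thesis` (stmt-NavierStokesRegularity-1832), negative side: `¬ Thesis` reduces to the local cascade equation

Negative-side (cdisprove, D-0016) support lemmas extracted from `Cruxes/Thesis/Disproof.lean` (cycle 1, §2).
`Thesis` (route target of `PerpetualPump`) is abstract Type-I exclusion over Tao's averaging class, and
`¬ Thesis ↔ AveragedTypeIBlowup` (landed `Negative/NSReduction.lean` of crux #3). Tao's **Theorem 3.2**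
— every local cascade operator (Def. 3.1) with dyadic parameter below an absolute threshold is an
averaged Euler operator — is a THEOREM of the tree (`Tao2016.localCascade_isAveraged_holds`). Hence:

* `isMildSolutionFor_congr` — trilinear forms that agree on `H¹⁰_df × H¹⁰_df × (H¹⁰_df ⊗ ℂ)` have the
  same `H¹⁰_df`-mild solutions on any initial time segment (the gluing step of "Thm 1.5 ⇐ Thms 3.2 + 3.3",
  p. 14, isolated for reuse);
* `not_thesis_of_cascade` — a Type-I-rate NON-EXTENDABLE mild solution of a symmetric cancelling
  LOCAL CASCADE EQUATION (3.3), available at arbitrarily fine dyadic parameter, refutes `Thesis` (it is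
  a witness of crux #3 `AveragedTypeIBlowup ↔ ¬ Thesis`).

So a disproof of `Thesis` never touches averaging data, multipliers, rotations or Theorem 3.2: its whole
PDE content is a cascade-level Type-I blow-up ("ODE pump + control of Lemma 4.1's inexact
diagonalisation", cruxes CircuitPump / PumpTransfer of the route, whose transfer target may be taken to
be the cascade equation). Nothing here closes the item (`--supports`); no statement of the route changes.

## References

* T. Tao, J. Amer. Math. Soc. 29 (2016), 601–674 = arXiv:1402.0290v3, §3 p. 14, Def. 3.1, (3.2)–(3.3),
  Thm. 3.2. [`Tao2016AveragedNS`]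
-/

noncomputable section

namespace Summit.NavierStokesRegularity.NavierStokesRegularity.Theorems.Thesis.Negative

open MeasureTheory Set Filter Topology
open scoped ENNReal SchwartzMap
open Literature.Analysis.FluidPDE Literature.Analysis.FluidPDE.Tao2016
open Summit.NavierStokesRegularity.NavierStokesRegularity.Theses.PerpetualPump
open Summit.NavierStokesRegularity.NavierStokesRegularity.Theorems.AveragedTypeIBlowup.Negative

/-- **Forms that agree on `H¹⁰_df × H¹⁰_df × (H¹⁰_df ⊗ ℂ)` have the same mild solutions** on every time
set `I ⊆ [0,∞)` that contains `[0,t]` together with each of its points `t`: the Duhamel identity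
(1.15)/(3.3) evaluates the form only at `(u(s), u(s), e^{(t-s)Δ}w)` with `u(s), w ∈ H¹⁰_df`,
`0 ≤ s ≤ t`, and `e^{τΔ}` maps `H¹⁰_df` into `H¹⁰_df ⊗ ℂ` (`MemH10dfC.heat`). The gluing step of Tao's
"Theorem 1.5 ⇐ Theorems 3.2 + 3.3" (p. 14), isolated. [cite: Tao2016AveragedNS, §3 p. 14] -/
theorem isMildSolutionFor_congr {F₁ F₂ : L2C → L2C → L2C → ℂ}
    (h : ∀ u v w, MemH10df u → MemH10df v → MemH10dfC w → F₁ u v w = F₂ u v w)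
    {I : Set ℝ} (hI0 : I ⊆ Ici 0) (hI : ∀ t ∈ I, Icc 0 t ⊆ I) {a : L2C} {u : ℝ → L2C} :
    IsMildSolutionFor F₁ a I u ↔ IsMildSolutionFor F₂ a I u := by
  have key : ∀ {G₁ G₂ : L2C → L2C → L2C → ℂ},
      (∀ u v w, MemH10df u → MemH10df v → MemH10dfC w → G₁ u v w = G₂ u v w) →
      IsMildSolutionFor G₁ a I u → IsMildSolutionFor G₂ a I u := by
    intro G₁ G₂ hG hu
    refine ⟨hu.1, hu.2.1, fun t ht w hw => ?_⟩
    rw [hu.2.2 t ht w hw]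
    congr 1
    refine intervalIntegral.integral_congr fun s hs => ?_
    rw [uIcc_of_le (show (0 : ℝ) ≤ t from hI0 ht)] at hs
    have hsI : s ∈ I := hI t ht hs
    exact hG _ _ _ (hu.1 s hsI) (hu.1 s hsI) (hw.memH10dfC.heat _)
  exact ⟨key h, key fun u v w hu hv hw => (h u v w hu hv hw).symm⟩

/-- Initial segments `[0,S)` contain `[0,t]` with each of their points `t`. [folklore] -/
theorem Icc_subset_Ico_of_mem_Ico {S t : ℝ} (ht : t ∈ Ico (0 : ℝ) S) : Icc 0 t ⊆ Ico 0 S :=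
  fun _ hs => ⟨hs.1, hs.2.trans_lt ht.2⟩

/-- **`¬ Thesis` from a cascade-level Type-I blow-up.** Suppose that for every threshold `ε₁ > 0`
there are a dyadic parameter `0 < ε₀ ≤ ε₁`, a symmetric local cascade form `C` (Def. 3.1) with the
cancellation (3.2), a Schwartz divergence-free datum, a time `S > 0` and an `H¹⁰_df`-mild solution of
(3.3) `∂ₜu = Δu + C(u,u)` on `[0,S)` at the Type-I rate `‖u(t)‖_∞ ≤ M (S-t)^{-1/2}` with NO mild
extension past `S`. Then the route target `Thesis` fails: by Theorem 3.2
(`localCascade_isAveraged_holds`) `C` is the form of an averaging datum `𝒜` on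
`H¹⁰_df × H¹⁰_df × (H¹⁰_df ⊗ ℂ)`; symmetry and cancellation transfer verbatim, mild solutions and mild
extensions of `C` and of `𝒜` correspond both ways (`isMildSolutionFor_congr`), the rate conjunct is
untouched, so `𝒜, u₀, S, u` witness `AveragedTypeIBlowup ↔ ¬ Thesis`. Consequently the PDE content of
ANY disproof of `Thesis` is exactly such a cascade-level object; averaging data, multipliers, rotations
and Theorem 3.2 never have to be touched again. [cite: Tao2016AveragedNS, Thm. 3.2 and §3 p. 14] -/
theorem not_thesis_of_cascade
    (h : ∀ ε₁ : ℝ, 0 < ε₁ → ∃ ε₀ : ℝ, 0 < ε₀ ∧ ε₀ ≤ ε₁ ∧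
      ∃ C : L2C → L2C → L2C → ℂ, IsLocalCascadeForm ε₀ C ∧
        (∀ u v w, MemH10df u → MemH10df v → MemH10df w → C u v w = C v u w) ∧
        (∀ u, MemH10df u → C u u u = 0) ∧
        ∃ u₀ : 𝓢(EuclideanSpace ℝ (Fin 3), EuclideanSpace ℝ (Fin 3)), VectorCalculus.IsDivFree ⇑u₀ ∧
          ∃ S : ℝ, 0 < S ∧ ∃ u : ℝ → L2C,
            IsMildSolutionFor C (schwartzL2 u₀) (Ico 0 S) u ∧
            (∃ M : ℝ, ∀ t ∈ Ico 0 S,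
              eLpNorm (u t) ⊤ volume ≤ ENNReal.ofReal (M / Real.sqrt (S - t))) ∧
            ¬ ∃ S' : ℝ, S < S' ∧ ∃ v : ℝ → L2C,
              IsMildSolutionFor C (schwartzL2 u₀) (Ico 0 S') v ∧ ∀ t ∈ Ico 0 S, v t = u t) :
    ¬ Thesis := by
  apply averagedTypeIBlowup_iff_not_thesis.1
  obtain ⟨ε₁, hε₁, h32⟩ := localCascade_isAveraged_holds
  obtain ⟨ε₀, hε₀, hle, C, hC, hsymm, hcanc, u₀, hdiv, S, hS, u, hmild, hrate, hno⟩ := h ε₁ hε₁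
  obtain ⟨𝒜, h𝒜⟩ := h32 ε₀ hε₀ hle C hC
  have hcongr : ∀ (R : ℝ) (v : ℝ → L2C),
      IsMildSolutionFor 𝒜.form (schwartzL2 u₀) (Ico 0 R) v ↔
        IsMildSolutionFor C (schwartzL2 u₀) (Ico 0 R) v :=
    fun R v => isMildSolutionFor_congr h𝒜 (fun t ht => ht.1) (fun t ht => Icc_subset_Ico_of_mem_Ico ht)
  refine ⟨𝒜, fun a b c ha hb hc => ?_, fun a ha => ?_, u₀, hdiv, S, hS, u, (hcongr S u).2 hmild,
    hrate, ?_⟩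
  · rw [h𝒜 a b c ha hb hc.memH10dfC, h𝒜 b a c hb ha hc.memH10dfC]
    exact hsymm a b c ha hb hc
  · rw [h𝒜 a a a ha ha ha.memH10dfC]
    exact hcanc a ha
  · rintro ⟨S', hSS', v, hv, hvu⟩
    exact hno ⟨S', hSS', v, (hcongr S' v).1 hv, hvu⟩

end Summit.NavierStokesRegularity.NavierStokesRegularity.Theorems.Thesis.Negative

end
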